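import Summits.NavierStokesRegularity.FluidComputer.ChainField
import Mathlib.Analysis.Calculus.Deriv.Comp
import Mathlib.Analysis.Calculus.Deriv.Mul
import HarnessLib

/-!
# The chain field is scale-covariant: amplitude homogeneity, uniform level ratio, rescaled solutions
# (the algebraic half of the scale map; `pub-fluidc-bp3/R1-DESIGN.md` §11.10 (iv)(a))

HONEST FRAMING (cell `pub-fluidc`, blueprint seat bp3, gen 22): low prior, high value-of-information
experiment on Tao's machine paradigm; NOT a claim that NS blows up.

WHAT. Three exact identities of the 9-mode window field `F g Λ` (any gate data `g`, any level
ratio `Λ`): (1) degree-two homogeneity `F(cX) = c²F(X)` (`F_smul`); (2) the window is discretely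
self-similar — on a state whose first block is spent down to `d₁ = 0`, the second gate's five
equations ARE the first gate's five equations at the shifted state, times `Λ` (`F_shift`; the only
cross term is the pump `κd₁²` into `a₂`); (3) hence solutions rescale: if `y` solves `ẏ = F(y)` then
`t ↦ c·y(ct)` solves it too (`solution_smul`) and `t ↦ y(κt)` solves `ẏ = κF(y)` (`solution_speed`),
so the scale-`n` window (`Λⁿ`-faster, amplitude `λₙ`) runs the same itinerary as
`RowChain.circuit_transfer` in time `∝ 1/(λₙΛⁿ)`. Pure algebra + the chain rule; nothing certified.

[cite: Tao2016AveragedNS, §5.5 Thm 5.3 (5.5)]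
-/

noncomputable section

namespace Summit.NavierStokesRegularity.FluidComputer

open Literature.Analysis.FluidPDE.FluidComputer

namespace ChainField

variable (g : GateData) (Λ : ℝ)

/-- **Homogeneity**: `F(cX) = c² F(X)`. [folklore] -/
theorem F_smul (c : ℝ) (X : Fin 9 → ℝ) : F g Λ (c • X) = c ^ 2 • F g Λ X := by
  ext i
  fin_cases i <;> simp [F, smul_eq_mul] <;> ring

/-- Shift a window state down one gate: `(a₂,b₂,c₂,d₂,e₂) ↦ (a₁,b₁,c₁,d₁,a₂)`, rest `0`.
[folklore] -/
def down (X : Fin 9 → ℝ) : Fin 9 → ℝ := ![X 4, X 5, X 6, X 7, X 8, 0, 0, 0, 0]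

/-- **Discrete self-similarity of the window**: the second gate's equations are `Λ` times the
first gate's at the shifted state, up to the pump `κd₁²` into `a₂`. [folklore] -/
theorem F_shift (X : Fin 9 → ℝ) :
    F g Λ X 4 = Λ * F g Λ (down X) 0 + g.κ * X 3 ^ 2 ∧ F g Λ X 5 = Λ * F g Λ (down X) 1 ∧
    F g Λ X 6 = Λ * F g Λ (down X) 2 ∧ F g Λ X 7 = Λ * F g Λ (down X) 3 ∧
    F g Λ X 8 = Λ * F g Λ (down X) 4 := by
  simp [F, down]
  refine ⟨by ring, by ring, by ring, by ring, by ring⟩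

variable {g Λ}

/-- **Amplitude rescaling of solutions**: `t ↦ c·y(ct)` solves the same ODE. [folklore] -/
theorem solution_smul {y : ℝ → Fin 9 → ℝ} (hsol : ∀ t, HasDerivAt y (F g Λ (y t)) t) (c : ℝ) :
    ∀ t, HasDerivAt (fun s => c • y (c * s)) (F g Λ (c • y (c * t))) t := by
  intro t
  have h1 : HasDerivAt (fun s => y (c * s)) (c • F g Λ (y (c * t))) t := by
    have h := (hsol (c * t)).scomp t ((hasDerivAt_id t).const_mul c)
    simp only [mul_one] at h
    exact h
  have h2 : HasDerivAt (fun s => c • y (c * s)) (c • c • F g Λ (y (c * t))) t := h1.const_smul c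
  rw [smul_smul, ← sq] at h2
  rw [F_smul]
  exact h2

/-- **Time rescaling of solutions**: `t ↦ y(κt)` solves `ẏ = κF(y)` (the `Λⁿ`-faster window).
[folklore] -/
theorem solution_speed {y : ℝ → Fin 9 → ℝ} (hsol : ∀ t, HasDerivAt y (F g Λ (y t)) t) (κ : ℝ) :
    ∀ t, HasDerivAt (fun s => y (κ * s)) (κ • F g Λ (y (κ * t))) t := by
  intro t
  have h := (hsol (κ * t)).scomp t ((hasDerivAt_id t).const_mul κ)
  simp only [mul_one] at h
  exact h

end ChainField

end Summit.NavierStokesRegularity.FluidComputer
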